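/-
Copyright (c) 2026 the pub-hodgecm-mathlib formalisation cell (harness21).  Prover seat hodgecm-mathlib-K2Liu-p09 (g6): Track B «K2-LIT»,
hLiu418 = stmt-HodgeConjecture-24832; LEAD F0P6-plan RULING M-158d «A7-val road (σ)», instance layer I-4a′ (values of `𝒜` at `1`, for K2Liu-p10's (σ-4)).
-/
import Summits.HodgeConjecture.HodgeConjecture.Theorems.K2LiuA7ValueInstanceSectionMap    -- ★ I-4a p860778 (`sectionMapLoc`, `coe_sectionMapLoc`)
import HarnessLib

/-!
# Crux `HLiu418`, road `K2_Liu`, organ A7-val, instance layer I-4a′: `(𝒜 Ψ)(1) = Ψ(0)` — THE NORMALISATION OF THE SECTION MAP AT THE IDENTITY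

Cell `hodgecm-mathlib`, crux item hLiu418 = `stmt-HodgeConjecture-24832`; squad K2 ∕ K2Liu; prover K2Liu-p09 (g6), organ lead A7-val.  THEOREMS ONLY; lane
`--supports stmt-HodgeConjecture-24832` (count-neutral helper).  Setting of ★ I-4a.
* **`sectionMapLoc_apply_one`**: `(𝒜 Ψ)(1) = f^Δ_Ψ(1) = (ω^Δ(s^Δ_B 1) Ψ)(0) = Ψ(0)` — the constant `κ` of K2Liu-p10 (g4)'s (σ-4) request (14:12:54Z) is `1`
  (`s^Δ_B` is a homomorphism, `ω^Δ(1) = 1`).  With ★ (L3-a) `coe_cM_eq_localSiegelCharacter` this pins `cM = localSiegelCharacter χ_v (½) ∘ (↑)` on `M_Δ`.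
HONEST LABEL.  `HC_CM` is proved only modulo the 7 printed citations (2 remaining named inputs: hLiu418 = `stmt-HodgeConjecture-24832`,
h413 = `stmt-HodgeConjecture-24833`) until rung 0 closes.

## References
* [KudlaRallis1994] S. Kudla, S. Rallis, Ann. of Math. 140 (1994), §1 (`f_Φ(1) = Φ(0)`).
-/

set_option autoImplicit false
set_option linter.dupNamespace false -- the mandated namespace repeats `HodgeConjecture.HodgeConjecture`

noncomputable section

open scoped Matrix TensorProduct Classical
open NumberField IsDedekindDomain Filter MeasureTheory
open Literature.RepresentationTheory.HeisenbergGroup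
open Literature.NumberTheory.Automorphic Literature.NumberTheory.Automorphic.UnitaryGroup Literature.NumberTheory.GaloisRepresentations
open Literature.NumberTheory.Weil1964 Literature.RepresentationTheory.HarrisKudlaSweet1996
open Literature.NumberTheory.GelbartRogawski1991 Literature.NumberTheory.GelbartRogawski1991.GRConstruction
open Literature.NumberTheory.GelbartRogawski1991.UnitaryDualPair
open Literature.NumberTheory.GelbartRogawski1991.UnitaryDualPair.LocalSplitting
open Literature.NumberTheory.K2Lit.SiegelDoubled Literature.NumberTheory.K2Lit.LocalSiegelDoubled
open Summit.HodgeConjecture.HodgeConjecture.Cruxes.HLiu418.K2LiuDoublingSchrodingerModelDefs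
open Summit.HodgeConjecture.HodgeConjecture.Cruxes.HLiu418.K2LiuLocalSWSectionDefs
open Summit.HodgeConjecture.HodgeConjecture.Cruxes.HLiu418.K2LiuSWSectionPlaceFactorisation
open Summit.HodgeConjecture.HodgeConjecture.Cruxes.HLiu418.K2LiuSWSectionTensorPlaceFactorisation
open Summit.HodgeConjecture.HodgeConjecture.Cruxes.HLiu418.K2LiuA7ValueInstanceSectionMap

namespace Summit.HodgeConjecture.HodgeConjecture.Cruxes.HLiu418.K2LiuA7ValueInstanceSectionMapValues

variable (L : Type) [Field L] [NumberField L] [IsCMField L] [Algebra.IsQuadraticExtension (Fp L) L]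
variable {N M n : ℕ} (e : Fin N × Fin M ≃ Fin n)
  (dV : Fin N → L) (hdV : ∀ i, IsCMField.complexConj L (dV i) = dV i) (hdV0 : ∀ i, dV i ≠ 0)
  (dW : Fin M → L) (hdW : ∀ i, IsCMField.complexConj L (dW i) = dW i) (hdW0 : ∀ i, dW i ≠ 0)
variable {M₂ M' n' : ℕ} (eW : Fin M × Fin M₂ ≃ Fin M') (e' : Fin N × Fin M' ≃ Fin n')
  (dV' : Fin M₂ → L) (hdV' : ∀ k, IsCMField.complexConj L (dV' k) = dV' k) (hdV'0 : ∀ k, dV' k ≠ 0) (hM₂ : M₂ ≠ 0)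
variable (χ : HeckeCharacter L) (𝔪 : ∀ v, PlaceMeasure L v)
  (𝓕 : FinLocalFamily L e' dV hdV hdV0 (tensorFrame L dW eW dV') (tensorFrame_real L dW hdW eW dV' hdV') (tensorFrame_ne_zero L dW eW dV' hdW0 hdV'0) χ 𝔪)
  (v : HeightOneSpectrum (𝓞 (Fp L)))
  [MeasurableSpace (Fin n' → v.adicCompletion (Fp L))] [BorelSpace (Fin n' → v.adicCompletion (Fp L))]
  (μ : Measure (Fin n' → v.adicCompletion (Fp L))) [μ.IsAddHaarMeasure]
  (Γ : SchwartzBruhat (Fin (n' + n') → v.adicCompletion (Fp L)) ≃ₗ[ℂ] SchwartzBruhat (Fin (n' + n') → v.adicCompletion (Fp L)))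
  (hΓ : IsDeltaIntertwiner L e' dV hdV (tensorFrame L dW eW dV') (tensorFrame_real L dW hdW eW dV' hdV') v Γ)
  (hΓ0 : ∀ Ψ : SchwartzBruhat (Fin (n' + n') → v.adicCompletion (Fp L)),
    ((Γ Ψ : SchwartzBruhat (Fin (n' + n') → v.adicCompletion (Fp L))) : (Fin (n' + n') → v.adicCompletion (Fp L)) → ℂ) 0 =
      diagIntegral (GRConstruction.e₂ (n := n')) μ Ψ)
  (s₀ : ℂ) (hs₀ : s₀ = ((M₂ : ℂ) - (n : ℂ)) / 2)

set_option maxHeartbeats 800000 in -- as ★ I-4a (the record pair behind `sectionMapLoc`)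
/-- **`(𝒜 Ψ)(1) = Ψ(0)`**: the Siegel–Weil section of `Ψ` along `s^Δ_B` takes the value `Ψ(0)` at the identity (`s^Δ_B 1 = 1`, `ω^Δ(1) = id`).
K2Liu-p10's `κ = 1`. [cite: KudlaRallis1994, §1] -/
theorem sectionMapLoc_apply_one (Ψ : SchwartzBruhat (Fin (n' + n') → v.adicCompletion (Fp L))) :
    ((sectionMapLoc L e dV hdV hdV0 dW hdW hdW0 eW e' dV' hdV' hdV'0 hM₂ χ 𝔪 𝓕 v μ Γ hΓ hΓ0 s₀ hs₀ Ψ :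
        ↥(localDegPS (Fp L) L (IsCMField.complexConj L) (complexConj_imagUnit L) (imagUnit_ne_zero L) (imagUnit_mul_self L)
          v n (gramR_isSymm L e dV hdV dW hdW) (hermD_eq_map_gramD L e dV hdV dW hdW) (fun w => (χ ^ M₂).localComponent w.1) s₀)) :
        UnitaryGroup.localPi L (IsCMField.complexConj L) (n + n) (hermD L e dV hdV dW hdW) v → ℂ) 1 =
      (Ψ : (Fin (n' + n') → v.adicCompletion (Fp L)) → ℂ) 0 := by
  rw [coe_sectionMapLoc, swSectionDelta_apply, MonoidHom.map_one, MonoidHom.map_one, Module.End.one_apply]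

end Summit.HodgeConjecture.HodgeConjecture.Cruxes.HLiu418.K2LiuA7ValueInstanceSectionMapValues

end
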